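import Mathlib.Analysis.Normed.Module.FiniteDimension
import Literature.Topology.Immersions.OpenParallelizableImmersionInduction
import HarnessLib

/-!
# Open parallelizable manifolds immerse in `ℝⁿ`: making a formal submersion holonomic at a point

Topic `Literature/Topology/Immersions`; part of the proof programme for the named fact
`Literature.Topology.Immersions.Phillips1967_exists_isLocalDiffeomorph_of_isParallelizable`
(Phillips 1967, Cor. 8.2, "if"), in the formal-solution language of
`OpenParallelizableImmersionInduction.lean`.

We prove the **local `h`-principle at a point, relative to a closed set**: a formal
submersion `(f, Ψ)` of the framed manifold `M`, holonomic near a closed set `U`, can be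
modified inside an arbitrarily small neighbourhood of a point `p ∉ U` so as to become
holonomic near `U ∪ {p}` (Eliashberg–Mishachev 2001, §1.1: *"any section is holonomic over
any point … take the Taylor polynomial map"*; here the affine map `A ∘ φ`, `φ` a chart at
`p`, with `A` chosen so that its frame derivative at `p` is exactly `Ψ p`). This is the step of
Phillips' handle induction for **handles of index `0`** ("attaching a handle of index `0` means
taking the disjoint union", §0 p. 174) — after it, the transport lemma
(`OpenParallelizableImmersionTransport.lean`) thickens the point to a disc — and it is the
`0`-dimensional case of holonomic approximation.

The new formal derivative is the straight-line interpolation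
`Ψ' = Ψ + χ • (J_σ(A ∘ φ) - Ψ)` by a bump `χ` concentrated at `p`; it stays linearly
independent because both ends are close to `Ψ p` near `p` and the set of linearly independent
families is open (`isOpen_setOf_linearIndependent`) — the openness of the submersion relation.

* `Literature.Topology.Immersions.exists_ball_subset_setOf_linearIndependent` — a sup-norm ball
  around a linearly independent family of `n` vectors of `ℝⁿ` consists of linearly independent
  families (openness + balls are convex-friendly neighbourhoods).
* `Literature.Topology.Immersions.HolonomicNear.insert` — the local modification lemma.

## References

* A. Phillips, *Submersions of open manifolds*, Topology **6** (1967), §0 p. 174, §2. [Phillips1967]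
* Y. Eliashberg, N. Mishachev, *Holonomic approximation and Gromov's h-principle*,
  arXiv:math/0101196 (2001), §1.1. [EliashbergMishachev2001]
-/

open scoped Manifold ContDiff Topology
open Set Function Filter Bundle Module Metric

noncomputable section

namespace Literature.Topology.Immersions

/-- Local notation: `𝔼 n` is the model Euclidean space `EuclideanSpace ℝ (Fin n)`. -/
local notation "𝔼 " n:arg => EuclideanSpace ℝ (Fin n)

variable {n : ℕ}

/-! ### Openness of linear independence, in a form fit for interpolation -/

/-- Around a linearly independent family `w₀` of vectors of `ℝⁿ` there is a (sup-norm) ball all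
of whose members are linearly independent families (`isOpen_setOf_linearIndependent`). Since
balls are convex, any convex combination of two families in the ball is again linearly
independent — the form in which the openness of the submersion relation is used. [folklore] -/
theorem exists_ball_subset_setOf_linearIndependent {ι : Type*} [Fintype ι] {w₀ : ι → 𝔼 n}
    (hw₀ : LinearIndependent ℝ w₀) :
    ∃ ε > 0, ∀ w : ι → 𝔼 n, dist w w₀ < ε → LinearIndependent ℝ w := by
  obtain ⟨ε, hε, hball⟩ := Metric.isOpen_iff.1 isOpen_setOf_linearIndependent w₀ hw₀
  exact ⟨ε, hε, fun w hw => hball (mem_ball.2 hw)⟩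

/-- Convex combinations stay in a ball: if `dist a c < ε`, `dist b c < ε` and `0 ≤ s ≤ 1` then
`dist (a + s • (b - a)) c < ε` (in any real normed space). [folklore] -/
theorem dist_add_smul_sub_lt {V : Type*} [SeminormedAddCommGroup V] [NormedSpace ℝ V]
    {a b c : V} {ε s : ℝ} (ha : dist a c < ε) (hb : dist b c < ε) (hs0 : 0 ≤ s) (hs1 : s ≤ 1) :
    dist (a + s • (b - a)) c < ε := by
  have hmem : a + s • (b - a) ∈ ball c ε := by
    have hseg : a + s • (b - a) ∈ segment ℝ a b := by
      rw [segment_eq_image']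
      exact ⟨s, ⟨hs0, hs1⟩, rfl⟩
    exact (convex_ball c ε).segment_subset (mem_ball.2 ha) (mem_ball.2 hb) hseg
  exact mem_ball.1 hmem

/-! ### Making a formal submersion holonomic at one more point -/

section Insert

variable {M : Type*} [TopologicalSpace M] [ChartedSpace (𝔼 n) M] [IsManifold (𝓡 n) ∞ M]
  {σ : Fin n → M → 𝔼 n}

/-- Frame derivative of `A ∘ φ` for a continuous linear map `A`: it is `A` applied to the frame
derivative of `φ` (chain rule; `φ` the extended chart, on its domain). [folklore] -/
theorem frameDeriv_clm_comp_extChartAt (A : 𝔼 n →L[ℝ] 𝔼 n) (x₀ : M) {x : M}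
    (hx : x ∈ (chartAt (𝔼 n) x₀).source) (i : Fin n) :
    frameDeriv σ (fun z => A (extChartAt (𝓡 n) x₀ z)) x i =
      A (frameDeriv σ (extChartAt (𝓡 n) x₀) x i) := by
  have hφ : MDifferentiableAt (𝓡 n) (𝓡 n) (extChartAt (𝓡 n) x₀) x :=
    (contMDiffOn_extChartAt.contMDiffAt ((chartAt (𝔼 n) x₀).open_source.mem_nhds hx)
      |>.mdifferentiableAt (by norm_num : (∞ : WithTop ℕ∞) ≠ 0))
  have hchain : mfderiv (𝓡 n) (𝓡 n) (fun z => A (extChartAt (𝓡 n) x₀ z)) x =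
      (mfderiv (𝓡 n) (𝓡 n) (⇑A) (extChartAt (𝓡 n) x₀ x)).comp
        (mfderiv (𝓡 n) (𝓡 n) (extChartAt (𝓡 n) x₀) x) :=
    mfderiv_comp x A.mdifferentiableAt hφ
  rw [frameDeriv_apply, hchain, ContinuousLinearMap.mfderiv_eq]
  rfl

variable [T2Space M]

/-- **Local `h`-principle at a point, relative to a closed set** (EM 2001 §1.1; the index-`0`
step of Phillips' handle induction, §0 p. 174 and §2). Let `σ` be a continuous frame of the
`C^∞` manifold `M` (Hausdorff), `(f, Ψ)` a formal submersion holonomic near the closed set `U`,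
`p ∉ U`, and `N` a neighbourhood of `p`. Then there is a formal submersion `(g, Ψ')` holonomic
near `U ∪ {p}` with `g = f` and `Ψ' = Ψ` outside `N`. Construction: `φ` the chart at `p`, `A`
the linear automorphism of `ℝⁿ` with `A (d φ_p (σᵢ p)) = Ψ p i`, `χ` a smooth bump at `p` with
small support; `g = f + χ • (A ∘ φ - f)`, `Ψ' = Ψ + χ • (J_σ (A ∘ φ) - Ψ)`. Near `p`,
`g = A ∘ φ` and `Ψ' = J_σ g`; linear independence of `Ψ'` on the support of `χ` holds because
`Ψ` and `J_σ(A ∘ φ)` are both close to `Ψ p` there and linearly independent families form an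
open set. [cite: EliashbergMishachev2001, §1.1] -/
theorem HolonomicNear.insert
    (hσ : ∀ i, Continuous fun x => (⟨x, σ i x⟩ : TangentBundle (𝓡 n) M))
    (hli : ∀ x, LinearIndependent ℝ fun i => σ i x) {f : M → 𝔼 n} {Ψ : M → Fin n → 𝔼 n}
    {U : Set M} (h : HolonomicNear σ f Ψ U) (hU : IsClosed U) {p : M} (hp : p ∉ U)
    {N : Set M} (hN : N ∈ 𝓝 p) :
    ∃ (g : M → 𝔼 n) (Ψ' : M → Fin n → 𝔼 n), HolonomicNear σ g Ψ' (insert p U) ∧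
      (∀ x ∉ N, g x = f x) ∧ (∀ x ∉ N, Ψ' x = Ψ x) := by
  classical
  -- the chart at `p`, and the linear map `A` matching `Ψ p`
  set φ := extChartAt (𝓡 n) p with hφ
  set S := (chartAt (𝔼 n) p).source with hS
  have hS_open : IsOpen S := (chartAt (𝔼 n) p).open_source
  have hpS : p ∈ S := mem_chart_source (𝔼 n) p
  set b : Basis (Fin n) ℝ (𝔼 n) := basisOfLinearIndependentOfCardEqFinrank'
    (frameDeriv σ φ p) (linearIndependent_frameDeriv_extChartAt hli hpS)
    ((Fintype.card_fin n).trans finrank_euclideanSpace_fin.symm) with hb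
  set A : 𝔼 n →L[ℝ] 𝔼 n := LinearMap.toContinuousLinearMap (b.constr ℝ (Ψ p)) with hA
  have hAb : ∀ i, A (frameDeriv σ φ p i) = Ψ p i := fun i => by
    have := b.constr_basis ℝ (Ψ p) i
    rw [hb, coe_basisOfLinearIndependentOfCardEqFinrank'] at this
    exact this
  -- the local solution `f₁ = A ∘ φ` and its frame derivative `J₁`
  set f₁ : M → 𝔼 n := fun z => A (φ z) with hf₁
  set J₁ : M → Fin n → 𝔼 n := fun x i => A (frameDeriv σ φ x i) with hJ₁
  have hJ₁S : ∀ x ∈ S, frameDeriv σ f₁ x = J₁ x := fun x hx =>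
    funext fun i => frameDeriv_clm_comp_extChartAt A p hx i
  have hJ₁p : J₁ p = Ψ p := funext hAb
  have hJ₁c : ContinuousOn J₁ S := by
    refine continuousOn_pi.2 fun i => ?_
    exact A.continuous.comp_continuousOn
      ((continuousOn_pi.1 (continuousOn_frameDeriv_extChartAt hσ p)) i)
  -- openness of linear independence around `Ψ p`
  obtain ⟨ε, hε, hεli⟩ := exists_ball_subset_setOf_linearIndependent (h.linearIndependent p)
  -- a small open neighbourhood `O` of `p`: inside `S ∩ N`, away from `U`, where `Ψ` and `J₁`
  -- are `ε`-close to `Ψ p`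
  have hΨnear : ∀ᶠ x in 𝓝 p, dist (Ψ x) (Ψ p) < ε :=
    Metric.tendsto_nhds.1 (h.continuous.tendsto p) ε hε
  have hJnear : ∀ᶠ x in 𝓝 p, dist (J₁ x) (Ψ p) < ε := by
    have ht : Tendsto J₁ (𝓝 p) (𝓝 (J₁ p)) := (hJ₁c.continuousAt (hS_open.mem_nhds hpS)).tendsto
    rw [hJ₁p] at ht
    exact Metric.tendsto_nhds.1 ht ε hε
  obtain ⟨O, hO_sub, hO_open, hpO⟩ : ∃ O : Set M, O ⊆ S ∩ N ∩ Uᶜ ∩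
      {x | dist (Ψ x) (Ψ p) < ε ∧ dist (J₁ x) (Ψ p) < ε} ∧ IsOpen O ∧ p ∈ O := by
    have hmem : S ∩ N ∩ Uᶜ ∩ {x | dist (Ψ x) (Ψ p) < ε ∧ dist (J₁ x) (Ψ p) < ε} ∈ 𝓝 p :=
      Filter.inter_mem (Filter.inter_mem (Filter.inter_mem (hS_open.mem_nhds hpS) hN)
        (hU.isOpen_compl.mem_nhds hp)) (hΨnear.and hJnear)
    exact mem_nhds_iff.1 hmem
  have hOS : O ⊆ S := fun x hx => (hO_sub hx).1.1.1
  have hON : O ⊆ N := fun x hx => (hO_sub hx).1.1.2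
  have hOU : O ⊆ Uᶜ := fun x hx => (hO_sub hx).1.2
  have hOΨ : ∀ x ∈ O, dist (Ψ x) (Ψ p) < ε := fun x hx => (hO_sub hx).2.1
  have hOJ : ∀ x ∈ O, dist (J₁ x) (Ψ p) < ε := fun x hx => (hO_sub hx).2.2
  -- a bump `χ` at `p` supported in `O`
  obtain ⟨χ, -, hχO⟩ := (SmoothBumpFunction.nhds_basis_tsupport (I := 𝓡 n) p).mem_iff.1
    (hO_open.mem_nhds hpO)
  have hχ0 : ∀ x ∉ O, χ x = 0 := fun x hx =>
    image_eq_zero_of_notMem_tsupport fun h' => hx (hχO h')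
  have hsuppO : ∀ x, χ x ≠ 0 → x ∈ O := fun x hx => by
    by_contra hxO
    exact hx (hχ0 x hxO)
  -- the new pair
  set g : M → 𝔼 n := fun x => f x + χ x • (f₁ x - f x) with hg
  set Ψ' : M → Fin n → 𝔼 n := fun x => Ψ x + χ x • (J₁ x - Ψ x) with hΨ'
  have hf₁S : ContMDiffOn (𝓡 n) (𝓡 n) ∞ f₁ S :=
    A.contMDiff.comp_contMDiffOn contMDiffOn_extChartAt
  have hg_smooth : ContMDiff (𝓡 n) (𝓡 n) ∞ g := by
    have h1 : ContMDiff (𝓡 n) (𝓡 n) ∞ fun x => χ x • f₁ x := χ.contMDiff_smul hf₁S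
    have h2 : ContMDiff (𝓡 n) (𝓡 n) ∞ fun x => χ x • f x := χ.contMDiff.smul h.contMDiff
    have : g = fun x => f x + (χ x • f₁ x - χ x • f x) := by
      funext x
      simp only [hg, smul_sub]
    rw [this]
    exact h.contMDiff.add (h1.sub h2)
  -- where `χ = 0`, nothing changes
  have hg_of : ∀ x, χ x = 0 → g x = f x := fun x hx => by simp [hg, hx]
  have hΨ'_of : ∀ x, χ x = 0 → Ψ' x = Ψ x := fun x hx => by simp [hΨ', hx]
  refine ⟨g, Ψ', ?_, fun x hx => hg_of x (hχ0 x fun h' => hx (hON h')),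
    fun x hx => hΨ'_of x (hχ0 x fun h' => hx (hON h'))⟩
  -- the holonomy region: `(V ∩ (tsupport χ)ᶜ) ∪ interior {χ = 1}`
  obtain ⟨V, hV_open, hUV, hVeq⟩ := h.exists_isOpen
  set W₁ : Set M := interior {x | χ x = 1} with hW₁
  have hpW₁ : p ∈ W₁ := by
    rw [hW₁, mem_interior_iff_mem_nhds]
    exact χ.eventuallyEq_one
  have hW₁1 : ∀ x ∈ W₁, χ x = 1 := fun x hx => by
    have h1 : x ∈ {y : M | χ y = 1} := interior_subset hx
    exact h1
  have hW₁O : W₁ ⊆ O := fun x hx => hsuppO x (by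
    rw [hW₁1 x hx]
    exact one_ne_zero)
  refine (HolonomicNear.of_isOpen (U := (V ∩ (tsupport χ)ᶜ) ∪ W₁)
    ((hV_open.inter (isClosed_tsupport χ).isOpen_compl).union isOpen_interior)
    hg_smooth ?_ ?_ ?_).mono ?_
  · -- continuity of `Ψ'`
    have hcont : Continuous fun x => χ x • (J₁ x - Ψ x) := by
      have h_on : ContinuousOn (fun x => χ x • (J₁ x - Ψ x)) S :=
        χ.continuous.continuousOn.smul (hJ₁c.sub h.continuous.continuousOn)
      have h_off : ContinuousOn (fun x => χ x • (J₁ x - Ψ x)) (tsupport χ)ᶜ := by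
        refine (continuousOn_const (c := (0 : Fin n → 𝔼 n))).congr fun x hx => ?_
        simp [image_eq_zero_of_notMem_tsupport hx]
      have hunion : S ∪ (tsupport χ)ᶜ = univ := by
        refine eq_univ_of_forall fun x => ?_
        by_cases hx : x ∈ tsupport χ
        · exact Or.inl (hOS (hχO hx))
        · exact Or.inr hx
      rw [← continuousOn_univ, ← hunion]
      exact h_on.union_of_isOpen h_off hS_open (isClosed_tsupport χ).isOpen_compl
    exact h.continuous.add hcont
  · -- linear independence of `Ψ' x`
    intro x
    by_cases hx : χ x = 0
    · rw [hΨ'_of x hx]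
      exact h.linearIndependent x
    · have hxO : x ∈ O := hsuppO x hx
      exact hεli _ (dist_add_smul_sub_lt (hOΨ x hxO) (hOJ x hxO) χ.nonneg χ.le_one)
  · -- holonomy on the region
    rintro x (⟨hxV, hxχ⟩ | hxW)
    · -- away from the bump: nothing changed
      have hχx : χ x = 0 := image_eq_zero_of_notMem_tsupport hxχ
      rw [hΨ'_of x hχx, hVeq x hxV]
      refine frameDeriv_congr_of_eventuallyEq ?_
      filter_upwards [(isClosed_tsupport χ).isOpen_compl.mem_nhds hxχ] with z hz
      exact (hg_of z (image_eq_zero_of_notMem_tsupport hz)).symm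
    · -- near `p`: `g = A ∘ φ` and `Ψ' = J₁`
      have hχx : χ x = 1 := hW₁1 x hxW
      have hxS : x ∈ S := hOS (hW₁O hxW)
      have hΨ'x : Ψ' x = J₁ x := by simp [hΨ', hχx]
      have hgev : g =ᶠ[𝓝 x] f₁ := by
        filter_upwards [isOpen_interior.mem_nhds hxW] with z hz
        have hz1 : χ z = 1 := hW₁1 z hz
        simp [hg, hz1]
      rw [hΨ'x, frameDeriv_congr_of_eventuallyEq hgev, hJ₁S x hxS]
  · -- `insert p U ⊆ region`
    rintro x (rfl | hxU)
    · exact Or.inr hpW₁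
    · exact Or.inl ⟨hUV hxU, fun hx => hOU (hχO hx) hxU⟩

end Insert

end Literature.Topology.Immersions
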